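import Literature.NumberTheory.NumberFields.AdicCompletionDyadicDepth
import HarnessLib

/-!
# The dyadic square-congruence criterion at a RAMIFIED (or any) dyadic place: `d t² = 1 + 8m ⇒ d a² ≡ ϖ^{2j}(1 + 8b) (mod v^N)`

Topic `NumberTheory/NumberFields`, namespace `Literature.NumberTheory.NumberFields`. Sequel of
`AdicCompletionDyadicDepth.lean`, whose `exists_sq_congr_of_mul_sq_eq_one_add` assumes `ord_v 2 = 1` (an unramified dyadic
place, so that `2` itself is a uniformiser and the congruence is read in `ℤ/2^N`). For the complete `2`-isogeny descents
over cubic `2`-division fields in which `2` RAMIFIES (every Kubert–Tate candidate after `E_{28/9}`: `E_{17/18}`, `E_{26/23}`,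
`E_{146/13}`, field discriminants `∓2³·…`), the same argument runs with a GLOBAL uniformiser `ϖ ∈ 𝓞 K`, `ord_v ϖ = 1`:

* `exists_sq_congr_of_mul_sq_eq_one_add_uniformizer` — at a place `v ∋ 2` with a global uniformiser `ϖ`,
  **`d t² = 1 + 8m` (`d ∈ 𝓞 K`, `t ∈ K_vˣ`, `m ∈ O_v`) gives `d a² ≡ ϖ^{2j} (1 + 8b) (mod v^N)`** with `a ∈ 𝓞 K ∖ v`,
  `b ∈ 𝓞 K`, `2j = ord_v d` (density of `𝓞 K` in `O_v` to depth `N`, `exists_eq_add_pow_mul`).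

The congruence is then decided in the finite ring `𝓞 K / v^N` (for a ramified degree-one prime, `(ℤ/2^k)[π]/(…)`), curve by
curve. Theorems only; no named facts.

## References
* [Neukirch1999] J. Neukirch, *Algebraic Number Theory* (1999), Ch. II Prop. 4.3 (`O/𝔭ⁿ ≅ Ô/𝔭̂ⁿ`).
* [SilvermanAEC2009] J. H. Silverman, *The Arithmetic of Elliptic Curves*, 2nd ed. (2009), Example X.4.10.
-/

noncomputable section

open IsLocalRing IsDedekindDomain NumberField

namespace Literature.NumberTheory.NumberFields

variable {K : Type*} [Field K] [NumberField K] (v : HeightOneSpectrum (𝓞 K))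

/-- **The dyadic criterion as a congruence, any ramification**: at a place `v ∋ 2` with a global uniformiser `ϖ`
(`v(ϖ) = exp(-1)`), if `d t² = 1 + 8m` in `K_v` (`d ∈ 𝓞 K`, `t ≠ 0`, `m ∈ O_v`) then for every `N ≥ 1` there are
`j : ℕ` (`2j = ord_v d`), `a ∈ 𝓞 K ∖ v` and `b ∈ 𝓞 K` with `d a² - ϖ^{2j}(1 + 8b) ∈ v^N`. [cite: Neukirch1999, Ch. II Prop. 4.3]
[cite: SilvermanAEC2009, Example X.4.10] -/
theorem exists_sq_congr_of_mul_sq_eq_one_add_uniformizer (ϖ : 𝓞 K) (hϖ : v.valuation K (ϖ : K) = WithZero.exp (-1))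
    (h2 : (2 : 𝓞 K) ∈ v.asIdeal) {N : ℕ} (hN : 1 ≤ N) (d : 𝓞 K) {t m : v.adicCompletion K} (ht : t ≠ 0) (hm : Valued.v m ≤ 1)
    (h : algebraMap K (v.adicCompletion K) (d : K) * t ^ 2 = 1 + 8 * m) :
    ∃ (j : ℕ) (a b : 𝓞 K), a ∉ v.asIdeal ∧ d * a ^ 2 - ϖ ^ (2 * j) * (1 + 8 * b) ∈ v.asIdeal ^ N := by
  have hval : ∀ x : K, Valued.v (algebraMap K (v.adicCompletion K) x) = v.valuation K x := fun x =>
    HeightOneSpectrum.valuedAdicCompletion_eq_valuation' v x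
  set ϖL : v.adicCompletion K := algebraMap K (v.adicCompletion K) (ϖ : K) with hϖL
  have hvϖ : Valued.v ϖL = WithZero.exp (-1) := by rw [hϖL, hval]; exact hϖ
  have hϖ0 : ϖL ≠ 0 := fun h0 => by rw [h0, map_zero] at hvϖ; exact WithZero.coe_ne_zero hvϖ.symm
  have hϖle : Valued.v ϖL ≤ 1 := by rw [hvϖ, ← WithZero.exp_zero, WithZero.exp_le_exp]; omega
  have hv2 : Valued.v (2 : v.adicCompletion K) < 1 := by
    rw [← map_ofNat (algebraMap K (v.adicCompletion K)) 2, hval, show (2 : K) = ((2 : 𝓞 K) : K) from rfl]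
    exact (HeightOneSpectrum.valuation_lt_one_iff_mem _ _).mpr h2
  have h2le : Valued.v (2 : v.adicCompletion K) ≤ 1 := hv2.le
  have h8 : Valued.v (1 + 8 * m) = 1 := by
    rw [Valuation.map_add_eq_of_lt_left _ ?_, map_one]
    rw [map_one, map_mul, show (8 : v.adicCompletion K) = 2 ^ 2 * 2 by norm_num, map_mul, map_pow]
    calc Valued.v (2 : v.adicCompletion K) ^ 2 * Valued.v (2 : v.adicCompletion K) * Valued.v m
        ≤ 1 ^ 2 * Valued.v (2 : v.adicCompletion K) * 1 := by gcongr; exact zero_le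
      _ < 1 := by rw [one_pow, one_mul, mul_one]; exact hv2
  -- `ord_v d = 2j`, `u = ϖ^j t` is a unit
  have hvt0 : Valued.v t ≠ 0 := (Valuation.ne_zero_iff _).mpr ht
  set n : ℤ := WithZero.log (Valued.v t) with hn
  have hvt : Valued.v t = WithZero.exp n := by rw [hn, WithZero.exp_log hvt0]
  have hvd : Valued.v (algebraMap K (v.adicCompletion K) (d : K)) = WithZero.exp (-(2 * n)) := by
    have hprod : Valued.v (algebraMap K (v.adicCompletion K) (d : K)) * Valued.v t ^ 2 = 1 := by
      rw [← map_pow, ← map_mul, h, h8]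
    have hd0 : Valued.v (algebraMap K (v.adicCompletion K) (d : K)) ≠ 0 := by
      intro h0; rw [h0, zero_mul] at hprod; exact zero_ne_one hprod
    have hlog := congrArg WithZero.log hprod
    rw [WithZero.log_mul hd0 (pow_ne_zero _ hvt0), WithZero.log_pow, WithZero.log_one, ← hn] at hlog
    rw [← WithZero.exp_log hd0]
    congr 1
    simp only [nsmul_eq_mul, Nat.cast_ofNat] at hlog
    omega
  have hn0 : 0 ≤ n := by
    have hle : Valued.v (algebraMap K (v.adicCompletion K) (d : K)) ≤ 1 := by
      rw [hval]; exact HeightOneSpectrum.valuation_le_one v d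
    rw [hvd, ← WithZero.exp_zero, WithZero.exp_le_exp] at hle
    omega
  obtain ⟨j, hj⟩ : ∃ j : ℕ, (j : ℤ) = n := ⟨n.toNat, Int.toNat_of_nonneg hn0⟩
  set u : v.adicCompletion K := t * ϖL ^ j with hu
  have hvu : Valued.v u = 1 := by
    rw [hu, map_mul, map_pow, hvt, hvϖ, ← WithZero.exp_nsmul, ← WithZero.exp_add, ← WithZero.exp_zero]
    congr 1; simp only [nsmul_eq_mul]; omega
  have hdu : algebraMap K (v.adicCompletion K) (d : K) * u ^ 2 = ϖL ^ (2 * j) * (1 + 8 * m) := by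
    rw [hu, mul_pow, ← pow_mul, ← h]; ring
  -- approximate `u` and `m` modulo `ϖ^N O_v`
  have huO : u ∈ v.adicCompletionIntegers K := by rw [HeightOneSpectrum.mem_adicCompletionIntegers]; exact hvu.le
  have hmO : m ∈ v.adicCompletionIntegers K := by rw [HeightOneSpectrum.mem_adicCompletionIntegers]; exact hm
  obtain ⟨a, u', hua⟩ := exists_eq_add_pow_mul v ϖ hϖ N ⟨u, huO⟩
  obtain ⟨b, m', hmb⟩ := exists_eq_add_pow_mul v ϖ hϖ N ⟨m, hmO⟩
  have hua' := congrArg (fun z : v.adicCompletionIntegers K => (z : v.adicCompletion K)) hua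
  have hmb' := congrArg (fun z : v.adicCompletionIntegers K => (z : v.adicCompletion K)) hmb
  push_cast at hua' hmb'
  simp only [coe_algebraMap_adicCompletionIntegers_eq] at hua' hmb'
  change u = algebraMap K _ (a : K) + (algebraMap K _ (ϖ : K)) ^ N * (u' : v.adicCompletion K) at hua'
  change m = algebraMap K _ (b : K) + (algebraMap K _ (ϖ : K)) ^ N * (m' : v.adicCompletion K) at hmb'
  rw [← hϖL] at hua' hmb'
  refine ⟨j, a, b, ?_, ?_⟩
  · -- `a ∉ v`: `v(a) = v(u - ϖ^N u') = 1`
    intro ha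
    have hva : Valued.v (algebraMap K (v.adicCompletion K) (a : K)) < 1 := by
      rw [hval]; exact (HeightOneSpectrum.valuation_lt_one_iff_mem _ _).mpr ha
    have hsmall : Valued.v (ϖL ^ N * (u' : v.adicCompletion K)) < 1 := by
      rw [map_mul, map_pow, hvϖ, ← WithZero.exp_nsmul]
      have hu'le : Valued.v (u' : v.adicCompletion K) ≤ 1 :=
        (HeightOneSpectrum.mem_adicCompletionIntegers _ K v).mp u'.2
      calc WithZero.exp (N • (-1 : ℤ)) * Valued.v (u' : v.adicCompletion K) ≤ WithZero.exp (N • (-1 : ℤ)) * 1 := by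
            gcongr
        _ < 1 := by rw [mul_one, ← WithZero.exp_zero, WithZero.exp_lt_exp]; simp only [nsmul_eq_mul]; omega
    have := lt_of_le_of_lt (Valuation.map_add _ _ _) (max_lt hva hsmall)
    rw [← hua', hvu] at this
    exact lt_irrefl _ this
  · -- `d a² - ϖ^{2j} (1 + 8 b) = ϖ^N · w` with `w ∈ O_v`
    set x : 𝓞 K := d * a ^ 2 - ϖ ^ (2 * j) * (1 + 8 * b) with hx
    by_cases hx0 : x = 0
    · rw [hx0]; exact zero_mem _
    rw [mem_pow_iff_log_valuation_le v hx0 N]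
    have hxL : algebraMap K (v.adicCompletion K) (x : K) = ϖL ^ N *
        (-(2 * algebraMap K (v.adicCompletion K) (d : K) * u * u') +
          ϖL ^ N * algebraMap K (v.adicCompletion K) (d : K) * u' ^ 2 + 8 * ϖL ^ (2 * j) * m') := by
      set g : 𝓞 K →+* v.adicCompletion K := (algebraMap K (v.adicCompletion K)).comp (algebraMap (𝓞 K) K) with hg
      have hgy : ∀ y : 𝓞 K, algebraMap K (v.adicCompletion K) (y : K) = g y := fun y => rfl
      have ea : g a = u - ϖL ^ N * u' := by rw [← hgy, hua']; ring
      have eb : g b = m - ϖL ^ N * m' := by rw [← hgy, hmb']; ring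
      have eϖ : g ϖ = ϖL := by rw [← hgy]
      rw [hgy] at hdu ⊢
      rw [hx, map_sub, map_mul, map_mul, map_pow, map_pow, map_add, map_mul, map_one, map_ofNat, ea, eb, eϖ]
      linear_combination hdu
    have hle : Valued.v (algebraMap K (v.adicCompletion K) (x : K)) ≤ WithZero.exp (-(N : ℤ)) := by
      rw [hxL, map_mul, map_pow, hvϖ, ← WithZero.exp_nsmul]
      have hint : Valued.v (-(2 * algebraMap K (v.adicCompletion K) (d : K) * u * u') +
          ϖL ^ N * algebraMap K (v.adicCompletion K) (d : K) * u' ^ 2 + 8 * ϖL ^ (2 * j) * m') ≤ 1 := by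
        have hdle : Valued.v (algebraMap K (v.adicCompletion K) (d : K)) ≤ 1 := by
          rw [hval]; exact HeightOneSpectrum.valuation_le_one v d
        have hu'le : Valued.v (u' : v.adicCompletion K) ≤ 1 :=
          (HeightOneSpectrum.mem_adicCompletionIntegers _ K v).mp u'.2
        have hm'le : Valued.v (m' : v.adicCompletion K) ≤ 1 :=
          (HeightOneSpectrum.mem_adicCompletionIntegers _ K v).mp m'.2
        have h8le : Valued.v (8 : v.adicCompletion K) ≤ 1 := by
          rw [show (8 : v.adicCompletion K) = 2 ^ 3 by norm_num, map_pow]; exact pow_le_one₀ zero_le h2le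
        have hϖNle : Valued.v (ϖL ^ N) ≤ 1 := by rw [map_pow]; exact pow_le_one₀ zero_le hϖle
        have hϖ2jle : Valued.v (ϖL ^ (2 * j)) ≤ 1 := by rw [map_pow]; exact pow_le_one₀ zero_le hϖle
        refine le_trans (Valuation.map_add _ _ _) (max_le (le_trans (Valuation.map_add _ _ _) (max_le ?_ ?_)) ?_)
        · rw [Valuation.map_neg, map_mul, map_mul, map_mul, hvu, mul_one]
          exact mul_le_one' (mul_le_one' h2le hdle) hu'le
        · rw [map_mul, map_mul, map_pow (Valued.v) (u' : v.adicCompletion K)]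
          exact mul_le_one' (mul_le_one' hϖNle hdle) (pow_le_one₀ zero_le hu'le)
        · rw [map_mul, map_mul]
          exact mul_le_one' (mul_le_one' h8le hϖ2jle) hm'le
      calc WithZero.exp (N • (-1 : ℤ)) * _ ≤ WithZero.exp (N • (-1 : ℤ)) * 1 := by gcongr
        _ = WithZero.exp (-(N : ℤ)) := by rw [mul_one]; simp only [nsmul_eq_mul, mul_neg, mul_one]
    have hx0' : Valued.v (algebraMap K (v.adicCompletion K) (x : K)) ≠ 0 := by
      rw [hval]; exact (Valuation.ne_zero_iff _).mpr (by exact_mod_cast hx0)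
    rw [← hval, WithZero.log_le_iff_le_exp hx0']
    exact hle

end Literature.NumberTheory.NumberFields

end
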